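import Summits.BirchSwinnertonDyer.Rank1Residual.X9.HessePartnerTransport
import HarnessLib

/-!
# Class X9, `p = 5`: Hesse-pencil transport with a RANK-0, NON-ANOMALOUS partner — the partner's C2 is its `L`-value (no modular symbols)

HONEST FRAMING (cell `b2b-bsdres-*`, verbatim): the cell deletes COMBINATION-SHAPED residual classes of
the rank-≤1 BSD formula from PUBLISHED theorems only and TYPES the construction-shaped remainder; this
is not "finishing BSD". Class X9 stays TYPED at class level; everything here is PER PAIR; no lane verdict is
changed; no named fact is introduced; nothing is booked by this unit. Unit `b2b-bsdres-x9`, gen 17 (companion of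
`X9/HessePartnerTransport.lean`).

## What this file does (our own work, hence `Summits/`)

The partners found beyond the tables (conductors `6·10⁵ … 3·10⁷`) are out of reach of every modular-symbol engine,
so the usual C2 certificate (a unit coefficient of `ϖ·L_5(f_F, α)` read off the modular symbols) cannot be computed.
For a partner `F` of analytic rank `0` that is NON-ANOMALOUS at `5` (`5 ∤ #F̃(𝔽₅)`, a kernel point count) the
CONSTANT coefficient is `(1 − α⁻¹)²·L(F,1)/Ω⁺_f` (Mazur–Tate–Teitelbaum interpolation, tree theorem), so C2 is the
two-engine `L`-VALUE certificate `L(F,1)/Ω_F = q_A` with `ord₅ q_A = 0` (`X9.unitCoeff_zero_of_lvalue`, gen 17). The two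
consumers below are `bsdp_of_ainvs_of_bsdpPartner_of_hessePencil5{ind}_of_analyticRank_le_one` with the binder `hcertA`
REPLACED by `hnaA : ¬ 5 ∣ n′₅` (kernel count), `hrA0 : r_an(F) = 0`, `hLA : L(F,1)/Ω_F = q_A`, `hqA : ord₅ q_A = 0`.

References: B. Mazur, J. Tate, J. Teitelbaum, Invent. Math. 84 (1986) §I.14 [MazurTateTeitelbaum1986Invent];
T. Fisher, Proc. LMS 104 (2012) Thm. 13.2 [Fisher2012Hessian]; Math. Ann. 356 (2013) Thm. 5.8 [Fisher2013QuinticTwists];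
R. Greenberg, V. Vatsal, Invent. Math. 142 (2000) Thm. (1.4) [GreenbergVatsal2000]; A. Burungale, F. Castella,
C. Skinner, IMRN 2025 Thm. 1.1.2 (a) [BurungaleCastellaSkinner2025]; B. Mazur, IHÉS 47 (1978) Prop. 6.3 (1) [Mazur1978].
-/

set_option autoImplicit false

noncomputable section

open scoped Classical MatrixGroups ModularForm

open CongruenceSubgroup WeierstrassCurve Literature.NumberTheory.EllipticCurves
  Literature.NumberTheory.EllipticCurves.ModularForms Literature.NumberTheory.EllipticCurves.Rank1Residual
  Literature.NumberTheory.EllipticCurves.Rank1Residual.Typed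
  Literature.NumberTheory.EllipticCurves.Rank1Residual.X11RankOneCertificates
  Literature.NumberTheory.EllipticCurves.Fisher2012
  Summit.BirchSwinnertonDyer.BirchSwinnertonDyer.Rank1Residual.IntModel
  Summit.BirchSwinnertonDyer.BirchSwinnertonDyer.Rank1Residual.X11RankOne
  Summit.BirchSwinnertonDyer.Rank1Residual.X11b

namespace Summit.BirchSwinnertonDyer.Rank1Residual.X9

/-- **RANK-0 NON-ANOMALOUS PARTNER in the Hesse pencil `X_E(5)`: C2 from the partner's `L`-value.** `BSD(E,5)` for a
target of analytic rank `≤ 1` exactly as `bsdp_of_ainvs_of_bsdpPartner_of_hessePencil5_of_analyticRank_le_one`, with the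
unit-coefficient binder `hcertA` REPLACED by: `hnaA : ¬ 5 ∣ #F̃(𝔽₅)` (the kernel point count `npA`), `hrA0 : r_an(F) = 0`, and the
`L`-value certificate `hLA : L(F,1)/Ω_F = q_A` with `hqA : ord₅ q_A = 0` (so `q_A ≠ 0` since `L(F,1) ≠ 0`); the unit coefficient is
then the constant one, by `unitCoeff_zero_of_lvalue` (Mazur–Tate–Teitelbaum interpolation `L_5(0) = (1 − α⁻¹)²·L(F,1)/Ω⁺_f`,
`1 − α⁻¹ = u·#F̃(𝔽₅)`, period unit). [cite: MazurTateTeitelbaum1986Invent, §I.14 (14.3)] [cite: Fisher2012Hessian, Thm. 13.2]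
[cite: GreenbergVatsal2000, Thm. (1.4) (arXiv p. 5)] [cite: BurungaleCastellaSkinner2025, Thm. 1.1.2 (a) (p. 2 of arXiv:2405.00270v2)] -/
theorem bsdp_of_ainvs_of_bsdpPartner_of_hessePencil5_of_lvalue_of_analyticRank_le_one
    (hF : thm132_fiveCongruent_hessePencil)
    (hBCS : burungale_castella_skinner_charIdeal_eq_padicLFunction)
    (hGr : greenberg_charValue_rankZero) (h5 : realPeriodRat_eq_unit_mul_plusPeriod)
    (hGV : GreenbergVatsal2000.thm14_mainConjecture_transfer_of_torsionIso)
    (hS : Schneider1985_order_charGenerator) (hPR : perrinRiou_rankOne_leadingTerms)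
    (hmodP : nonempty_modularParametrizationData) (hmodL : hasEntireLFunction_rat)
    (hGZK : rank_eq_analyticRank_of_analyticRank_le_one)
    (a1 a2 a3 a4 a6 : ℤ) {W : WeierstrassCurve ℚ} [W.IsElliptic] [W.IsGloballyMinimal]
    (hW : integralModelInt W = ⟨a1, a2, a3, a4, a6⟩)
    (b1 b2 b3 b4 b6 : ℤ) {A : WeierstrassCurve ℚ} [A.IsElliptic] [A.IsGloballyMinimal]
    (hA : integralModelInt A = ⟨b1, b2, b3, b4, b6⟩)
    (ℓ n np npA : ℕ) [Fact ℓ.Prime] [Fact (Nat.Prime 5)]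
    (hpΔ : ¬ (5 : ℤ) ∣ discOf [a1, a2, a3, a4, a6])
    (hcardp : Nat.card (((⟨a1, a2, a3, a4, a6⟩ : WeierstrassCurve ℤ).map
      (Int.castRingHom (ZMod 5))).toAffine.Point) = np)
    (hordp : ¬ (5 : ℤ) ∣ (5 : ℤ) + 1 - np)
    (hℓp : ℓ ≠ 5) (hℓΔ : ¬ (ℓ : ℤ) ∣ discOf [a1, a2, a3, a4, a6])
    (hcard : Nat.card (((⟨a1, a2, a3, a4, a6⟩ : WeierstrassCurve ℤ).map
      (Int.castRingHom (ZMod ℓ))).toAffine.Point) = n)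
    (hnoroot : ∀ t : ℕ, t < 5 → ¬ (5 : ℤ) ∣ (t : ℤ) ^ 2 - ((ℓ : ℤ) + 1 - n) * t + ℓ)
    (hpΔA : ¬ (5 : ℤ) ∣ discOf [b1, b2, b3, b4, b6])
    (hcardpA : Nat.card (((⟨b1, b2, b3, b4, b6⟩ : WeierstrassCurve ℤ).map
      (Int.castRingHom (ZMod 5))).toAffine.Point) = npA)
    (hordpA : ¬ (5 : ℤ) ∣ (5 : ℤ) + 1 - npA)
    (hran : W.analyticRank ≤ 1) (hbsdA : BSDp A 5)
    (hSchA : A.analyticRank = 1 → ∀ Dh : PAdicHeightData A 5, Dh.IsCanonical → SchneiderConjecture Dh)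
    (hnaA : ¬ 5 ∣ npA) (hrA0 : A.analyticRank = 0)
    {qA : ℚ} (hLA : A.entireLFunction 1 / (A.realPeriodRat : ℂ) = (qA : ℂ)) (hqA : padicValRat 5 qA = 0)
    (l m : ℚ) (C : VariableChange ℚ) (hC : C • A = hessePencil5 W.c₄ W.c₆ l m)
    (hC3 : W.analyticRank = 1 → ∀ Dh : PAdicHeightData W 5, Dh.IsCanonical → SchneiderConjecture Dh) :
    BSDp W 5 := by
  have hΔ : (⟨a1, a2, a3, a4, a6⟩ : WeierstrassCurve ℤ).Δ = discOf [a1, a2, a3, a4, a6] :=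
    intCurve_Δ a1 a2 a3 a4 a6
  have hΔA : (⟨b1, b2, b3, b4, b6⟩ : WeierstrassCurve ℤ).Δ = discOf [b1, b2, b3, b4, b6] :=
    intCurve_Δ b1 b2 b3 b4 b6
  have hgood : W.HasGoodReductionAtPrime 5 :=
    hasGoodReductionAtPrime_of_not_dvd W 5 (by rw [minimalDiscriminantInt_eq hW, hΔ]; exact hpΔ)
  have hord : ¬ ((5 : ℕ) : ℤ) ∣ W.frobeniusTrace 5 := by
    rw [frobeniusTrace_eq hW hcardp]; exact_mod_cast hordp
  have hgoodA : A.HasGoodReductionAtPrime 5 :=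
    hasGoodReductionAtPrime_of_not_dvd A 5 (by rw [minimalDiscriminantInt_eq hA, hΔA]; exact hpΔA)
  have hordA : ¬ ((5 : ℕ) : ℤ) ∣ A.frobeniusTrace 5 := by
    rw [frobeniusTrace_eq hA hcardpA]; exact_mod_cast hordpA
  have hirr : W.HasIrreducibleModPGaloisRep 5 := by
    refine hasIrreducibleModPGaloisRep_of_intModel_of_noroot hW 5 ℓ hℓp (by rw [hΔ]; exact hℓΔ) hcard
      (forall_zmod_of_forall_lt fun t ht h0 ↦ ?_)
    refine hnoroot t ht ?_
    have h5 : ((5 : ℕ) : ℤ) ∣ (t : ℤ) ^ 2 - ((ℓ : ℤ) + 1 - n) * t + ℓ := by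
      rw [← ZMod.intCast_zmod_eq_zero_iff_dvd]
      push_cast at h0 ⊢
      linear_combination h0
    exact_mod_cast h5
  obtain ⟨e, he⟩ := torsionIso_of_hessePencil5 hF W A l m C hC
  have hirrA : A.HasIrreducibleModPGaloisRep 5 := hasIrreducibleModPGaloisRep_of_torsionIso_symm e he hirr
  have hrA : A.analyticRank ≤ 1 := by rw [hrA0]; exact Nat.zero_le 1
  have hna : ¬ 5 ∣ A.reductionPointCount 5 := by
    unfold WeierstrassCurve.reductionPointCount; rw [hA, hcardpA]; exact hnaA
  have hqA0 : qA ≠ 0 := by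
    intro h0
    have hL0 : A.entireLFunction 1 ≠ 0 := (A.analyticRank_eq_zero_iff_holds (hmodL A)).1 hrA0
    have hΩ : (A.realPeriodRat : ℂ) ≠ 0 := Complex.ofReal_ne_zero.mpr A.realPeriodRat_pos_holds.ne'
    rw [h0, Rat.cast_zero, div_eq_zero_iff] at hLA
    exact hLA.elim hL0 hΩ
  exact bsdp_of_bsdpPartner_of_partnerRank_le_one_of_irr W A 5 hBCS hGr h5 hGV hS hPR hmodP hmodL hGZK
    hran hgood hord (le_refl 5) hirr hgoodA hordA hrA hbsdA hSchA
    (unitCoeff_zero_of_lvalue h5 A 5 (le_refl 5) hgoodA hordA hirrA hna hqA0 hLA hqA)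
    (torsionIso_of_hessePencil5 hF W A l m C hC) hC3

/-- **The same for a partner in the indirect family `X_E⁻(5)`** (Fisher 2013 Thm. 5.8, named fact `hF'`).
[cite: Fisher2013QuinticTwists, Thm. 5.8] [cite: GreenbergVatsal2000, Thm. (1.4) (arXiv p. 5)]
[cite: BurungaleCastellaSkinner2025, Thm. 1.1.2 (a) (p. 2 of arXiv:2405.00270v2)] [cite: Mazur1978, §6 Prop. 6.3 (1) (p. 153)] -/
theorem bsdp_of_ainvs_of_bsdpPartner_of_hessePencil5ind_of_lvalue_of_analyticRank_le_one
    (hF' : thm58_fiveCongruent_hessePencilInd)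
    (hBCS : burungale_castella_skinner_charIdeal_eq_padicLFunction)
    (hGr : greenberg_charValue_rankZero) (h5 : realPeriodRat_eq_unit_mul_plusPeriod)
    (hGV : GreenbergVatsal2000.thm14_mainConjecture_transfer_of_torsionIso)
    (hS : Schneider1985_order_charGenerator) (hPR : perrinRiou_rankOne_leadingTerms)
    (hmodP : nonempty_modularParametrizationData) (hmodL : hasEntireLFunction_rat)
    (hGZK : rank_eq_analyticRank_of_analyticRank_le_one)
    (a1 a2 a3 a4 a6 : ℤ) {W : WeierstrassCurve ℚ} [W.IsElliptic] [W.IsGloballyMinimal]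
    (hW : integralModelInt W = ⟨a1, a2, a3, a4, a6⟩)
    (b1 b2 b3 b4 b6 : ℤ) {A : WeierstrassCurve ℚ} [A.IsElliptic] [A.IsGloballyMinimal]
    (hA : integralModelInt A = ⟨b1, b2, b3, b4, b6⟩)
    (ℓ n np npA : ℕ) [Fact ℓ.Prime] [Fact (Nat.Prime 5)]
    (hpΔ : ¬ (5 : ℤ) ∣ discOf [a1, a2, a3, a4, a6])
    (hcardp : Nat.card (((⟨a1, a2, a3, a4, a6⟩ : WeierstrassCurve ℤ).map
      (Int.castRingHom (ZMod 5))).toAffine.Point) = np)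
    (hordp : ¬ (5 : ℤ) ∣ (5 : ℤ) + 1 - np)
    (hℓp : ℓ ≠ 5) (hℓΔ : ¬ (ℓ : ℤ) ∣ discOf [a1, a2, a3, a4, a6])
    (hcard : Nat.card (((⟨a1, a2, a3, a4, a6⟩ : WeierstrassCurve ℤ).map
      (Int.castRingHom (ZMod ℓ))).toAffine.Point) = n)
    (hnoroot : ∀ t : ℕ, t < 5 → ¬ (5 : ℤ) ∣ (t : ℤ) ^ 2 - ((ℓ : ℤ) + 1 - n) * t + ℓ)
    (hpΔA : ¬ (5 : ℤ) ∣ discOf [b1, b2, b3, b4, b6])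
    (hcardpA : Nat.card (((⟨b1, b2, b3, b4, b6⟩ : WeierstrassCurve ℤ).map
      (Int.castRingHom (ZMod 5))).toAffine.Point) = npA)
    (hordpA : ¬ (5 : ℤ) ∣ (5 : ℤ) + 1 - npA)
    (hran : W.analyticRank ≤ 1) (hbsdA : BSDp A 5)
    (hSchA : A.analyticRank = 1 → ∀ Dh : PAdicHeightData A 5, Dh.IsCanonical → SchneiderConjecture Dh)
    (hnaA : ¬ 5 ∣ npA) (hrA0 : A.analyticRank = 0)
    {qA : ℚ} (hLA : A.entireLFunction 1 / (A.realPeriodRat : ℂ) = (qA : ℂ)) (hqA : padicValRat 5 qA = 0)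
    (l m : ℚ) (C : VariableChange ℚ) (hC : C • A = hessePencil5ind W.c₄ W.c₆ l m)
    (hC3 : W.analyticRank = 1 → ∀ Dh : PAdicHeightData W 5, Dh.IsCanonical → SchneiderConjecture Dh) :
    BSDp W 5 := by
  have hΔ : (⟨a1, a2, a3, a4, a6⟩ : WeierstrassCurve ℤ).Δ = discOf [a1, a2, a3, a4, a6] :=
    intCurve_Δ a1 a2 a3 a4 a6
  have hΔA : (⟨b1, b2, b3, b4, b6⟩ : WeierstrassCurve ℤ).Δ = discOf [b1, b2, b3, b4, b6] :=
    intCurve_Δ b1 b2 b3 b4 b6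
  have hgood : W.HasGoodReductionAtPrime 5 :=
    hasGoodReductionAtPrime_of_not_dvd W 5 (by rw [minimalDiscriminantInt_eq hW, hΔ]; exact hpΔ)
  have hord : ¬ ((5 : ℕ) : ℤ) ∣ W.frobeniusTrace 5 := by
    rw [frobeniusTrace_eq hW hcardp]; exact_mod_cast hordp
  have hgoodA : A.HasGoodReductionAtPrime 5 :=
    hasGoodReductionAtPrime_of_not_dvd A 5 (by rw [minimalDiscriminantInt_eq hA, hΔA]; exact hpΔA)
  have hordA : ¬ ((5 : ℕ) : ℤ) ∣ A.frobeniusTrace 5 := by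
    rw [frobeniusTrace_eq hA hcardpA]; exact_mod_cast hordpA
  have hirr : W.HasIrreducibleModPGaloisRep 5 := by
    refine hasIrreducibleModPGaloisRep_of_intModel_of_noroot hW 5 ℓ hℓp (by rw [hΔ]; exact hℓΔ) hcard
      (forall_zmod_of_forall_lt fun t ht h0 ↦ ?_)
    refine hnoroot t ht ?_
    have h5 : ((5 : ℕ) : ℤ) ∣ (t : ℤ) ^ 2 - ((ℓ : ℤ) + 1 - n) * t + ℓ := by
      rw [← ZMod.intCast_zmod_eq_zero_iff_dvd]
      push_cast at h0 ⊢
      linear_combination h0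
    exact_mod_cast h5
  obtain ⟨e, he⟩ := torsionIso_of_hessePencil5ind hF' W A l m C hC
  have hirrA : A.HasIrreducibleModPGaloisRep 5 := hasIrreducibleModPGaloisRep_of_torsionIso_symm e he hirr
  have hrA : A.analyticRank ≤ 1 := by rw [hrA0]; exact Nat.zero_le 1
  have hna : ¬ 5 ∣ A.reductionPointCount 5 := by
    unfold WeierstrassCurve.reductionPointCount; rw [hA, hcardpA]; exact hnaA
  have hqA0 : qA ≠ 0 := by
    intro h0
    have hL0 : A.entireLFunction 1 ≠ 0 := (A.analyticRank_eq_zero_iff_holds (hmodL A)).1 hrA0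
    have hΩ : (A.realPeriodRat : ℂ) ≠ 0 := Complex.ofReal_ne_zero.mpr A.realPeriodRat_pos_holds.ne'
    rw [h0, Rat.cast_zero, div_eq_zero_iff] at hLA
    exact hLA.elim hL0 hΩ
  exact bsdp_of_bsdpPartner_of_partnerRank_le_one_of_irr W A 5 hBCS hGr h5 hGV hS hPR hmodP hmodL hGZK
    hran hgood hord (le_refl 5) hirr hgoodA hordA hrA hbsdA hSchA
    (unitCoeff_zero_of_lvalue h5 A 5 (le_refl 5) hgoodA hordA hirrA hna hqA0 hLA hqA)
    (torsionIso_of_hessePencil5ind hF' W A l m C hC) hC3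


end Summit.BirchSwinnertonDyer.Rank1Residual.X9

end
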